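import Literature.NumberTheory.Weil1964.AdelicMetaplecticTwistCharacter
import Literature.NumberTheory.Weil1964.AdelicMetaplecticFinRepConj
import Literature.NumberTheory.Weil1964.AdelicMetaplecticFinRepTensorConj
import HarnessLib

/-!
# Conjugating a splitting by an implementer: the finite factors are conjugate, up to a character

Topic `NumberTheory/Weil1964`; namespace `Literature.NumberTheory.Weil1964`.  THEOREMS ONLY (no definition, no named fact, no instance,
no `sorry`).  Cell `hodgecm-mathlib`, FLOOR-0 P4 seat S4′, the generic core (road (G), steps (iii)–(iv) of A-p17 (g12)'s `LT-census`
34b2b5ca) of the finite-adelic LINE TRANSPORT (F0P4-p01 (g0) memo fb85b676 §2): nothing here mentions a line or a dual pair.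

SETTING ([Weil1964] Chap. III n° 37–38; [GelbartRogawski1991] §3.1 p. 454, Remark p. 457 L9–13; [MoeglinVignerasWaldspurger1987]
Chap. 2 II.1).  `Mp_ψ(W_T)ᶜᵒⁿᵗ = adelicMpCont F ι T` is the tree's metaplectic group of record over the adelic symplectic space
`(𝔸_F^ι × 𝔸_F^ι, β_T)`, `T` invertible, with `π = adelicMpCont.proj`, `ω = adelicMpCont.omega`, the central extension
`1 → ℂˣ → Mp_ψ(W_T)ᶜᵒⁿᵗ → Sp(W_T)(𝔸) → 1` (★ `AdelicMetaplecticProjSurjective`, `AdelicMetaplecticKernel`), and, for a homomorphism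
`s : H →* Mp_ψ(W_T)ᶜᵒⁿᵗ` whose symplectic components fix the archimedean vectors, the FINITE FACTOR ★ `finRepMp hT s harch : H → End 𝒮((𝔸_F^∞)^ι)`
with `ω(s h) = 1 ⊗ finRepMp s h` (★ `AdelicMetaplecticFinRep`).

* §1 (private plumbing) `archVec_fixed_inv` — `π(P⁻¹)` fixes the archimedean vectors when `π(P)` does (for the conjugated
  homomorphism `h ↦ P · s h · P⁻¹` this is ★ `archVec_fixed_conj` of `AdelicMetaplecticFinRepTensorConj`, imported).
* §2 **`finPart_omega_mul_finPart_omega_inv`** ∕ **`exists_linearEquiv_finPart_omega`** — for such a `P`, `finPart ω(P)` and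
  `finPart ω(P⁻¹)` are mutually inverse, i.e. `ω(P) = 1 ⊗ Q`, `ω(P⁻¹) = 1 ⊗ Q⁻¹` for a linear AUTOMORPHISM `Q` of `𝒮((𝔸_F^∞)^ι)` — exactly the
  pure-tensor hypotheses `hq hq′` (with `A = 1`) of ★ `AdelicMetaplecticFinRepTensorConj.finRepMp_conj_apply`.
* §3 **`omega_conj_map_tmul`** ∕ **`finRepMp_conj_eq_finPart_comp`** — `finRepMp (P s P⁻¹) h = finPart ω(P) ∘ finRepMp s h ∘ finPart ω(P⁻¹)`:
  the finite factor of the conjugated homomorphism is the conjugate of the finite factor (the `finPart` form of ★ `finRepMp_conj_apply`).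
* §4 **`exists_character_finRepMp_eq_smul_conj`** ∕ **`exists_linearEquiv_character_finRepMp_eq_smul_conj`** — if `s₁, s₂ : H →* Mp_ψ(W_T)ᶜᵒⁿᵗ` (symplectic components fixing the archimedean
  vectors) and `P` (likewise) satisfy `π(s₂ h) = π(P) π(s₁ h) π(P)⁻¹` for all `h`, then for a CHARACTER `χ : H →* ℂˣ`:
  `finRepMp s₂ h = χ(h) • (finPart ω(P) ∘ finRepMp s₁ h ∘ finPart ω(P⁻¹))` — two homomorphisms over the same symplectic map differ by
  a character (★ `adelicMpCont.exists_eq_twist`), applied to `s₂` and `P s₁ P⁻¹`.  With ★ `adelicMpCont.proj_surjective` (every adelic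
  symplectic automorphism HAS such a `P` when it fixes the archimedean vectors) this is the engine of every «transport along a non-rational
  adelic isometry» of finite Weil representations — e.g. between the carriers of [Liu2021, Def. 4.11] at two lines with the same local classes.

HC_CM is proved only modulo the 7 printed citations until rung 0 closes; this file proves nothing about them.

## References
* [Weil1964] A. Weil, *Sur certains groupes d'opérateurs unitaires*, Acta Math. 111 (1964), Chap. III n° 37–38 pp. 188–190.
* [GelbartRogawski1991] S. Gelbart, J. Rogawski, Invent. Math. 105 (1991), §3.1 p. 454 L21–33, Remark p. 457 L9–13.
* [MoeglinVignerasWaldspurger1987] C. Mœglin, M.-F. Vignéras, J.-L. Waldspurger, LNM 1291, Chap. 2 II.1 (A)–(B).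
-/

set_option autoImplicit false

noncomputable section

open scoped TensorProduct SchwartzMap Classical
open NumberField NumberField.mixedEmbedding IsDedekindDomain

namespace Literature.NumberTheory.Weil1964

open Literature.NumberTheory.Automorphic Literature.RepresentationTheory.HeisenbergGroup

variable {F : Type} [Field F] [NumberField F] {ι : Type} [Fintype ι] [DecidableEq ι]
  {T : Matrix ι ι (AdeleRing (𝓞 F) F)} {H : Type*} [Group H]

/- IMPLEMENTATION NOTE.  `rw` with a pattern containing a PRODUCT in `Mp_ψ(W_T)ᶜᵒⁿᵗ` (e.g. `rw [map_mul]` on `π (p * q)`) makes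
`kabstract` compare, at default transparency, every other `⇑π x` ∕ `⇑ω x` subterm of the goal with the product, and the failing
unification `x =?= p * q` unfolds the unit-group structure of `Mp_ψ` through several structure-eta layers — a deterministic
time-out at 200 000 heartbeats.  All proofs below therefore go through `simp only` (reducible matching) or explicit `congrArg` ∕
`Eq.trans` chains, never through `rw` with product patterns. -/

/-! ## §1 Fixing the archimedean vectors passes to inverses -/

section ArchFixed

/-- `π(p⁻¹) (π(p) x) = x`. [folklore] -/
private theorem proj_inv_fst_apply_apply (p : adelicMpCont F ι T) (x : (ι → AdeleRing (𝓞 F) F) × (ι → AdeleRing (𝓞 F) F)) :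
    (adelicMpCont.proj F ι T p⁻¹).1 ((adelicMpCont.proj F ι T p).1 x) = x := by
  simp only [map_inv, Subgroup.coe_inv, LinearEquiv.coe_inv]
  exact (adelicMpCont.proj F ι T p).1.symm_apply_apply x

/-- inverses of elements whose symplectic components fix the archimedean vectors fix them. [folklore] -/
private theorem archVec_fixed_inv {p : adelicMpCont F ι T}
    (hp : ∀ a w : ι → mixedSpace F, (adelicMpCont.proj F ι T p).1 (archVec F ι a, archVec F ι w) = (archVec F ι a, archVec F ι w))
    (a w : ι → mixedSpace F) :
    (adelicMpCont.proj F ι T p⁻¹).1 (archVec F ι a, archVec F ι w) = (archVec F ι a, archVec F ι w) :=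
  calc (adelicMpCont.proj F ι T p⁻¹).1 (archVec F ι a, archVec F ι w)
      = (adelicMpCont.proj F ι T p⁻¹).1 ((adelicMpCont.proj F ι T p).1 (archVec F ι a, archVec F ι w)) :=
        (congrArg (fun y => (adelicMpCont.proj F ι T p⁻¹).1 y) (hp a w)).symm
    _ = (archVec F ι a, archVec F ι w) := proj_inv_fst_apply_apply p _

/-- bookkeeping: `(P · s · P⁻¹) h = P (s h) P⁻¹`. [folklore] -/
private theorem conj_comp_apply (P : adelicMpCont F ι T) (s : H →* adelicMpCont F ι T) (h : H) :
    ((MulAut.conj P).toMonoidHom.comp s) h = P * s h * P⁻¹ := rfl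

end ArchFixed

/-! ## §2 The finite part of an implementer fixing the archimedean vectors is invertible -/

section FinPartInverse

omit [DecidableEq ι] in
/-- bookkeeping, for ANY representation `ρ` of a monoid on `𝒮(𝔸_F^ι)`: if `ρ(p) = 1 ⊗ C`, `ρ(q) = 1 ⊗ C′` and `p q = 1`, then
`C C′ = 1` (`ρ` multiplicative, `finPart (1 ⊗ B) = B`; stated for an abstract monoid so that no unfolding of a concrete group law is
ever attempted). [cite: Weil1964, Chap. III n° 37–38 p. 188–190] -/
theorem mul_eq_one_of_eq_adelicTensorEnd_id {G : Type*} [Monoid G] (ρ : Representation ℂ G ↥(piSchwartzBruhat F ι))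
    {p q : G} {C C' : FinSB F ι →ₗ[ℂ] FinSB F ι}
    (hp : ρ p = adelicTensorEnd LinearMap.id C) (hq : ρ q = adelicTensorEnd LinearMap.id C') (hpq : p * q = 1) :
    C * C' = 1 := by
  have hid : (LinearMap.id : 𝓢((ι → mixedSpace F), ℂ) →ₗ[ℂ] 𝓢((ι → mixedSpace F), ℂ)) * LinearMap.id = LinearMap.id :=
    LinearMap.ext fun _ => rfl
  have key : adelicTensorEnd LinearMap.id (C * C') = ρ 1 := by
    rw [← hid, adelicTensorEnd_mul, ← hp, ← hq, ← map_mul, hpq]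
  rw [map_one] at key
  have h := congrArg (finPart F ι) key
  rwa [finPart_adelicTensorEnd_id, finPart_one] at h

/-- **`finPart ω(P)` and `finPart ω(P⁻¹)` are inverse to each other** when `π(P)` fixes the archimedean vectors.
[cite: Weil1964, Chap. III n° 37–38 p. 188–190] -/
theorem finPart_omega_mul_finPart_omega_inv (hT : IsUnit T) (P : adelicMpCont F ι T)
    (hP : ∀ a w : ι → mixedSpace F, (adelicMpCont.proj F ι T P).1 (archVec F ι a, archVec F ι w) = (archVec F ι a, archVec F ι w)) :
    finPart F ι (adelicMpCont.omega F ι T P) * finPart F ι (adelicMpCont.omega F ι T P⁻¹) = 1 ∧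
      finPart F ι (adelicMpCont.omega F ι T P⁻¹) * finPart F ι (adelicMpCont.omega F ι T P) = 1 := by
  have h1 := (exists_eq_adelicTensorEnd_id_left_iff _).1 (exists_omega_eq_adelicTensorEnd_id_left hT P hP)
  have h2 := (exists_eq_adelicTensorEnd_id_left_iff _).1
    (exists_omega_eq_adelicTensorEnd_id_left hT P⁻¹ (archVec_fixed_inv hP))
  exact ⟨mul_eq_one_of_eq_adelicTensorEnd_id _ h1 h2 (mul_inv_cancel P),
    mul_eq_one_of_eq_adelicTensorEnd_id _ h2 h1 (inv_mul_cancel P)⟩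

/-- **`ω(P) = 1 ⊗ Q`, `ω(P⁻¹) = 1 ⊗ Q⁻¹` for a linear automorphism `Q` of `𝒮((𝔸_F^∞)^ι)` with `Q = finPart ω(P)`**, when `π(P)` fixes
the archimedean vectors — the pure-tensor hypotheses (`A = 1`) under which ★ `AdelicMetaplecticFinRepTensorConj.finRepMp_conj_apply`
conjugates finite factors. [cite: Weil1964, Chap. III n° 37–38 p. 188–190] [cite: GelbartRogawski1991, §3.1 Prop. 3.1.1 p. 455] -/
theorem exists_linearEquiv_finPart_omega (hT : IsUnit T) (P : adelicMpCont F ι T)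
    (hP : ∀ a w : ι → mixedSpace F, (adelicMpCont.proj F ι T P).1 (archVec F ι a, archVec F ι w) = (archVec F ι a, archVec F ι w)) :
    ∃ Q : FinSB F ι ≃ₗ[ℂ] FinSB F ι,
      (Q : FinSB F ι →ₗ[ℂ] FinSB F ι) = finPart F ι (adelicMpCont.omega F ι T P) ∧
      (Q.symm : FinSB F ι →ₗ[ℂ] FinSB F ι) = finPart F ι (adelicMpCont.omega F ι T P⁻¹) ∧
      (∀ (Φ : 𝓢((ι → mixedSpace F), ℂ)) (f : FinSB F ι),
        adelicMpCont.omega F ι T P (piSchwartzBruhatEquiv F ι (Φ ⊗ₜ f)) = piSchwartzBruhatEquiv F ι (Φ ⊗ₜ Q f)) ∧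
      (∀ (Φ : 𝓢((ι → mixedSpace F), ℂ)) (f : FinSB F ι),
        adelicMpCont.omega F ι T P⁻¹ (piSchwartzBruhatEquiv F ι (Φ ⊗ₜ f)) = piSchwartzBruhatEquiv F ι (Φ ⊗ₜ Q.symm f)) := by
  have h12 := finPart_omega_mul_finPart_omega_inv hT P hP
  have e1 := (exists_eq_adelicTensorEnd_id_left_iff _).1 (exists_omega_eq_adelicTensorEnd_id_left hT P hP)
  have e2 := (exists_eq_adelicTensorEnd_id_left_iff _).1
    (exists_omega_eq_adelicTensorEnd_id_left hT P⁻¹ (archVec_fixed_inv hP))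
  refine ⟨LinearEquiv.ofLinear (finPart F ι (adelicMpCont.omega F ι T P)) (finPart F ι (adelicMpCont.omega F ι T P⁻¹)) h12.1 h12.2,
    rfl, rfl, fun Φ f => ?_, fun Φ f => ?_⟩
  · exact (LinearMap.congr_fun e1 _).trans (adelicTensorEnd_apply_tmul _ _ _ _)
  · exact (LinearMap.congr_fun e2 _).trans (adelicTensorEnd_apply_tmul _ _ _ _)

end FinPartInverse

/-! ## §3 The finite factor of the conjugated homomorphism -/

section Conj

/-- `ω(P)` on pure tensors: `ω(P) (Φ ⊗ f) = Φ ⊗ finPart ω(P) f`. [cite: Weil1964, Chap. III n° 37–38 p. 188–190] -/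
theorem omega_map_tmul_of_archVec_fixed (hT : IsUnit T) (P : adelicMpCont F ι T)
    (hP : ∀ a w : ι → mixedSpace F, (adelicMpCont.proj F ι T P).1 (archVec F ι a, archVec F ι w) = (archVec F ι a, archVec F ι w))
    (Φ : 𝓢((ι → mixedSpace F), ℂ)) (f : FinSB F ι) :
    adelicMpCont.omega F ι T P (piSchwartzBruhatEquiv F ι (Φ ⊗ₜ f)) =
      piSchwartzBruhatEquiv F ι (Φ ⊗ₜ finPart F ι (adelicMpCont.omega F ι T P) f) := by
  have h := (exists_eq_adelicTensorEnd_id_left_iff _).1 (exists_omega_eq_adelicTensorEnd_id_left hT P hP)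
  exact (LinearMap.congr_fun h _).trans (adelicTensorEnd_apply_tmul _ _ _ _)

/-- `ω(P s h P⁻¹) = ω(P) ω(s h) ω(P⁻¹)`. [folklore] -/
private theorem omega_conj_comp_apply (P : adelicMpCont F ι T) (s : H →* adelicMpCont F ι T) (h : H) :
    adelicMpCont.omega F ι T (((MulAut.conj P).toMonoidHom.comp s) h) =
      adelicMpCont.omega F ι T P * adelicMpCont.omega F ι T (s h) * adelicMpCont.omega F ι T P⁻¹ := by
  simp only [conj_comp_apply, map_mul]

/-- **`ω(P s h P⁻¹) (Φ ⊗ f) = Φ ⊗ (finPart ω(P) (finRepMp s h (finPart ω(P⁻¹) f)))`** — the conjugated homomorphism on pure tensors.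
[cite: Weil1964, Chap. III n° 37–38 p. 188–190] [cite: MoeglinVignerasWaldspurger1987, Chap. 2 II.1 (A)] -/
theorem omega_conj_map_tmul (hT : IsUnit T) (s : H →* adelicMpCont F ι T)
    (harch : ∀ (h : H) (a w : ι → mixedSpace F),
      (adelicMpCont.proj F ι T (s h)).1 (archVec F ι a, archVec F ι w) = (archVec F ι a, archVec F ι w))
    (P : adelicMpCont F ι T)
    (hP : ∀ a w : ι → mixedSpace F, (adelicMpCont.proj F ι T P).1 (archVec F ι a, archVec F ι w) = (archVec F ι a, archVec F ι w))
    (h : H) (Φ : 𝓢((ι → mixedSpace F), ℂ)) (f : FinSB F ι) :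
    adelicMpCont.omega F ι T (((MulAut.conj P).toMonoidHom.comp s) h) (piSchwartzBruhatEquiv F ι (Φ ⊗ₜ f)) =
      piSchwartzBruhatEquiv F ι (Φ ⊗ₜ
        finPart F ι (adelicMpCont.omega F ι T P) (finRepMp hT s harch h (finPart F ι (adelicMpCont.omega F ι T P⁻¹) f))) := by
  have e2 := omega_map_tmul_of_archVec_fixed hT P⁻¹ (archVec_fixed_inv hP) Φ f
  have e3 := omega_map_tmul_finRepMp hT s harch h Φ (finPart F ι (adelicMpCont.omega F ι T P⁻¹) f)
  have e4 := omega_map_tmul_of_archVec_fixed hT P hP Φ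
    (finRepMp hT s harch h (finPart F ι (adelicMpCont.omega F ι T P⁻¹) f))
  calc adelicMpCont.omega F ι T (((MulAut.conj P).toMonoidHom.comp s) h) (piSchwartzBruhatEquiv F ι (Φ ⊗ₜ f))
      = (adelicMpCont.omega F ι T P * adelicMpCont.omega F ι T (s h) * adelicMpCont.omega F ι T P⁻¹)
          (piSchwartzBruhatEquiv F ι (Φ ⊗ₜ f)) := LinearMap.congr_fun (omega_conj_comp_apply P s h) _
    _ = adelicMpCont.omega F ι T P (adelicMpCont.omega F ι T (s h)
          (adelicMpCont.omega F ι T P⁻¹ (piSchwartzBruhatEquiv F ι (Φ ⊗ₜ f)))) := rfl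
    _ = adelicMpCont.omega F ι T P (adelicMpCont.omega F ι T (s h)
          (piSchwartzBruhatEquiv F ι (Φ ⊗ₜ finPart F ι (adelicMpCont.omega F ι T P⁻¹) f))) :=
        congrArg (fun v => adelicMpCont.omega F ι T P (adelicMpCont.omega F ι T (s h) v)) e2
    _ = adelicMpCont.omega F ι T P (piSchwartzBruhatEquiv F ι (Φ ⊗ₜ
          finRepMp hT s harch h (finPart F ι (adelicMpCont.omega F ι T P⁻¹) f))) :=
        congrArg (fun v => adelicMpCont.omega F ι T P v) e3
    _ = piSchwartzBruhatEquiv F ι (Φ ⊗ₜ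
          finPart F ι (adelicMpCont.omega F ι T P) (finRepMp hT s harch h (finPart F ι (adelicMpCont.omega F ι T P⁻¹) f))) := e4

/-- **`finRepMp (P s P⁻¹) h = finPart ω(P) ∘ finRepMp s h ∘ finPart ω(P⁻¹)`**: conjugating a homomorphism into `Mp_ψ(W_T)ᶜᵒⁿᵗ` by an
element `P` whose symplectic component fixes the archimedean vectors conjugates the finite factor by `finPart ω(P)` (uniqueness of the
finite factor, ★ `finRepMp_unique`; the `finPart` form of ★ `finRepMp_conj_apply`). [cite: Weil1964, Chap. III n° 37–38 p. 188–190] [cite: MoeglinVignerasWaldspurger1987, Chap. 2 II.1 (A)] -/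
theorem finRepMp_conj_eq_finPart_comp (hT : IsUnit T) (s : H →* adelicMpCont F ι T)
    (harch : ∀ (h : H) (a w : ι → mixedSpace F),
      (adelicMpCont.proj F ι T (s h)).1 (archVec F ι a, archVec F ι w) = (archVec F ι a, archVec F ι w))
    (P : adelicMpCont F ι T)
    (hP : ∀ a w : ι → mixedSpace F, (adelicMpCont.proj F ι T P).1 (archVec F ι a, archVec F ι w) = (archVec F ι a, archVec F ι w))
    (h : H) :
    finRepMp hT ((MulAut.conj P).toMonoidHom.comp s) (archVec_fixed_conj s harch P) h =
      finPart F ι (adelicMpCont.omega F ι T P) ∘ₗ finRepMp hT s harch h ∘ₗ finPart F ι (adelicMpCont.omega F ι T P⁻¹) :=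
  (finRepMp_unique hT _ _ h unitSchwartz_ne_zero' fun f => by
    simpa only [LinearMap.coe_comp, Function.comp_apply] using omega_conj_map_tmul hT s harch P hP h (unitSchwartz F ι) f).symm

end Conj

/-! ## §4 Two homomorphisms CONJUGATE OVER `π(P)`: the finite factors are conjugate up to a character -/

section ConjUpToCharacter

/-- **Finite factors of homomorphisms conjugate over an adelic symplectic element.**  Let `s₁ s₂ : H →* Mp_ψ(W_T)ᶜᵒⁿᵗ` and
`P ∈ Mp_ψ(W_T)ᶜᵒⁿᵗ` have symplectic components fixing the archimedean vectors, and suppose `π(s₂ h) = π(P) π(s₁ h) π(P)⁻¹` for all `h`.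
Then there is a character `χ : H →* ℂˣ` with `finRepMp s₂ h = χ(h) • (finPart ω(P) ∘ finRepMp s₁ h ∘ finPart ω(P⁻¹))` for all `h`:
`s₂` and `P s₁ P⁻¹` lie over the same symplectic map, so `s₂ = (P s₁ P⁻¹) ⊗ χ` (★ `adelicMpCont.exists_eq_twist`), and §3.
[cite: GelbartRogawski1991, §3.1 Remark p. 457 L9–13] [cite: Weil1964, Chap. III n° 37–38 p. 188–190] -/
theorem exists_character_finRepMp_eq_smul_conj (hT : IsUnit T) (s₁ s₂ : H →* adelicMpCont F ι T)
    (harch₁ : ∀ (h : H) (a w : ι → mixedSpace F),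
      (adelicMpCont.proj F ι T (s₁ h)).1 (archVec F ι a, archVec F ι w) = (archVec F ι a, archVec F ι w))
    (harch₂ : ∀ (h : H) (a w : ι → mixedSpace F),
      (adelicMpCont.proj F ι T (s₂ h)).1 (archVec F ι a, archVec F ι w) = (archVec F ι a, archVec F ι w))
    (P : adelicMpCont F ι T)
    (hP : ∀ a w : ι → mixedSpace F, (adelicMpCont.proj F ι T P).1 (archVec F ι a, archVec F ι w) = (archVec F ι a, archVec F ι w))
    (hconj : ∀ h : H, adelicMpCont.proj F ι T (s₂ h) =
      adelicMpCont.proj F ι T P * adelicMpCont.proj F ι T (s₁ h) * (adelicMpCont.proj F ι T P)⁻¹) :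
    ∃ χ : H →* ℂˣ, ∀ h : H,
      finRepMp hT s₂ harch₂ h =
        ((χ h : ℂˣ) : ℂ) •
          (finPart F ι (adelicMpCont.omega F ι T P) ∘ₗ finRepMp hT s₁ harch₁ h ∘ₗ finPart F ι (adelicMpCont.omega F ι T P⁻¹)) := by
  -- `P s₁ P⁻¹` and `s₂` lie over the same symplectic map
  have hproj : ∀ h : H,
      adelicMpCont.proj F ι T (((MulAut.conj P).toMonoidHom.comp s₁) h) = adelicMpCont.proj F ι T (s₂ h) := fun h => by
    simp only [conj_comp_apply, map_mul, map_inv, hconj h]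
  refine (adelicMpCont.exists_eq_twist _ _ hT hproj).elim fun χ hχ => ⟨χ, fun h => ?_⟩
  -- read `s₂ = (P s₁ P⁻¹) ⊗ χ` on pure tensors `φ₀ ⊗ f` and use the uniqueness of the finite factor
  refine (finRepMp_unique hT s₂ harch₂ h unitSchwartz_ne_zero' fun f => ?_).symm
  have e2 := omega_conj_map_tmul hT s₁ harch₁ P hP h (unitSchwartz F ι) f
  calc adelicMpCont.omega F ι T (s₂ h) (piSchwartzBruhatEquiv F ι (unitSchwartz F ι ⊗ₜ f))
      = ((χ h : ℂˣ) : ℂ) • adelicMpCont.omega F ι T (((MulAut.conj P).toMonoidHom.comp s₁) h)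
          (piSchwartzBruhatEquiv F ι (unitSchwartz F ι ⊗ₜ f)) :=
        adelicMpCont.omega_eq_smul_of_eq_twist hχ h _
    _ = ((χ h : ℂˣ) : ℂ) • piSchwartzBruhatEquiv F ι (unitSchwartz F ι ⊗ₜ
          finPart F ι (adelicMpCont.omega F ι T P)
            (finRepMp hT s₁ harch₁ h (finPart F ι (adelicMpCont.omega F ι T P⁻¹) f))) :=
        congrArg (fun v => ((χ h : ℂˣ) : ℂ) • v) e2
    _ = piSchwartzBruhatEquiv F ι (((χ h : ℂˣ) : ℂ) • (unitSchwartz F ι ⊗ₜ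
          finPart F ι (adelicMpCont.omega F ι T P)
            (finRepMp hT s₁ harch₁ h (finPart F ι (adelicMpCont.omega F ι T P⁻¹) f)))) :=
        (LinearEquiv.map_smul (piSchwartzBruhatEquiv F ι) _ _).symm
    _ = piSchwartzBruhatEquiv F ι (unitSchwartz F ι ⊗ₜ (((χ h : ℂˣ) : ℂ) •
          finPart F ι (adelicMpCont.omega F ι T P)
            (finRepMp hT s₁ harch₁ h (finPart F ι (adelicMpCont.omega F ι T P⁻¹) f)))) :=
        congrArg (fun t => piSchwartzBruhatEquiv F ι t) (TensorProduct.tmul_smul _ _ _).symm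
    _ = piSchwartzBruhatEquiv F ι (unitSchwartz F ι ⊗ₜ (((χ h : ℂˣ) : ℂ) •
          (finPart F ι (adelicMpCont.omega F ι T P) ∘ₗ finRepMp hT s₁ harch₁ h ∘ₗ
            finPart F ι (adelicMpCont.omega F ι T P⁻¹))) f) := by
        simp only [LinearMap.smul_apply, LinearMap.coe_comp, Function.comp_apply]

/-- **The same, with the conjugating operator packaged as a linear AUTOMORPHISM `Q` (`Q = finPart ω(P)`, `Q⁻¹ = finPart ω(P⁻¹)`):**
`finRepMp s₂ h = χ(h) • Q.conj (finRepMp s₁ h)` — the consumable shape of the «transport along an adelic isometry» of finite Weil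
representations. [cite: GelbartRogawski1991, §3.1 Remark p. 457 L9–13] [cite: Weil1964, Chap. III n° 37–38 p. 188–190] -/
theorem exists_linearEquiv_character_finRepMp_eq_smul_conj (hT : IsUnit T) (s₁ s₂ : H →* adelicMpCont F ι T)
    (harch₁ : ∀ (h : H) (a w : ι → mixedSpace F),
      (adelicMpCont.proj F ι T (s₁ h)).1 (archVec F ι a, archVec F ι w) = (archVec F ι a, archVec F ι w))
    (harch₂ : ∀ (h : H) (a w : ι → mixedSpace F),
      (adelicMpCont.proj F ι T (s₂ h)).1 (archVec F ι a, archVec F ι w) = (archVec F ι a, archVec F ι w))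
    (P : adelicMpCont F ι T)
    (hP : ∀ a w : ι → mixedSpace F, (adelicMpCont.proj F ι T P).1 (archVec F ι a, archVec F ι w) = (archVec F ι a, archVec F ι w))
    (hconj : ∀ h : H, adelicMpCont.proj F ι T (s₂ h) =
      adelicMpCont.proj F ι T P * adelicMpCont.proj F ι T (s₁ h) * (adelicMpCont.proj F ι T P)⁻¹) :
    ∃ (Q : FinSB F ι ≃ₗ[ℂ] FinSB F ι) (χ : H →* ℂˣ),
      (Q : FinSB F ι →ₗ[ℂ] FinSB F ι) = finPart F ι (adelicMpCont.omega F ι T P) ∧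
      (Q.symm : FinSB F ι →ₗ[ℂ] FinSB F ι) = finPart F ι (adelicMpCont.omega F ι T P⁻¹) ∧
      ∀ h : H, finRepMp hT s₂ harch₂ h = ((χ h : ℂˣ) : ℂ) • Q.conj (finRepMp hT s₁ harch₁ h) := by
  have h12 := finPart_omega_mul_finPart_omega_inv hT P hP
  refine (exists_character_finRepMp_eq_smul_conj hT s₁ s₂ harch₁ harch₂ P hP hconj).elim fun χ hχ =>
    ⟨LinearEquiv.ofLinear (finPart F ι (adelicMpCont.omega F ι T P)) (finPart F ι (adelicMpCont.omega F ι T P⁻¹)) h12.1 h12.2,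
      χ, rfl, rfl, fun h => (hχ h).trans (congrArg (fun B => ((χ h : ℂˣ) : ℂ) • B) (LinearMap.ext fun f => ?_))⟩
  simp only [LinearMap.coe_comp, Function.comp_apply, LinearEquiv.conj_apply_apply, LinearEquiv.ofLinear_apply,
    LinearEquiv.ofLinear_symm_apply]

end ConjUpToCharacter

end Literature.NumberTheory.Weil1964

end
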